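import Literature.NumberTheory.EllipticCurves.SelmerLevelToPrimary
import Literature.NumberTheory.EllipticCurves.SelmerCorankAssembly
import Literature.NumberTheory.EllipticCurves.SelmerPInftyGaloisAction
import HarnessLib

/-!
# Crux U1 `KolyvaginBoundedDefectAtTwo` (stmt-BirchSwinnertonDyer-28083), LINE 17 `regular_core_rigidity`,
# toward the START FRAME stub (N3″) — the dictionary `Sel^(p^k)(E/K) ↔ Sel_{p^∞}(E/K)[p^k]`, surjective half

Width seat `bsd-line-krr2-p2` g15 (ONE READER on S1b); `--supports stmt-BirchSwinnertonDyer-28083` (helper).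
THEOREMS ONLY; nothing here proves the start frame, S1b, U1, a rung or BSD. BSD is NOT proved.

The tree's `torsionPowToPrimaryH1 W p M : H¹(K, E[p^M]) →+ H¹(K, E[p^∞])` (file `SelmerLevelToPrimary`) comes with
injectivity (`torsionPowToPrimaryH1_injective_of_torsionBy_eq_bot`) and `Sel^(p^M) → Sel_{p^∞}`
(`torsionPowToPrimaryH1_mem_selmerGroupPInfty`); the SURJECTION onto the `p^M`-torsion is in the tree only inside the
existential `Literature.Barriers.….exists_torsionToPrimaryHom`. This file states it for the named map (the plan of
`Cruxes/KolyvaginBoundedDefectAtTwo/S1-READER-g15.md`, Addendum B, step 1):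
* `exists_torsionPowToPrimaryH1_eq` — **`H¹(K, E[p^M]) ↠ H¹(K, E[p^∞])[p^M]`** (the cocycle argument of the level-`p`
  `exists_torsionToPrimaryH1_eq`, divisibility of `E(K̄)` by `p^M`);
* `torsionPowToPrimaryH1_mem_selmerGroupPInfty_iff` — `Sel^(p^M)(E/K)` is EXACTLY the preimage of `Sel_{p^∞}(E/K)`;
* `exists_mem_selmerGroup_torsionPowToPrimaryH1_eq` — **`Sel^(p^M)(E/K) ↠ Sel_{p^∞}(E/K)[p^M]`**;
* `conjH1Primary_torsionPowToPrimaryH1` (`_conjAct`) — `Aut(K/ℚ)`-equivariance of the level-`p^M` map.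
With injectivity (`E(K)[p] = 0` on U1's frame) this is `Sel^(2^M)(E/K) ≅ Sel_{2^∞}(E/K)[2^M]`, the bridge through which
the start frame (eigen-basis of the divisible part) descends to every level. [cite: Greenberg1999, §2 (p. 62–63), §5
(p. 114, proof of Prop. 5.8)] [cite: SilvermanAEC2009, X.§4]
Design: no definitions; axioms `propext`, `Classical.choice`, `Quot.sound`.
-/

set_option autoImplicit false
-- the Theorems namespace of this sub repeats the summit name by design (D-0017 nested layout)
set_option linter.dupNamespace false

noncomputable section

open scoped Classical
open WeierstrassCurve Literature.NumberTheory.EllipticCurves Literature.NumberTheory.GaloisRepresentations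
open Literature.Barriers.BirchSwinnertonDyer (geomTorsion_pow_le_geomPrimaryTorsion)

namespace Summit.BirchSwinnertonDyer.BirchSwinnertonDyer.Theorems.KolyvaginAtTwo.RegularWalk

universe u

variable {K : Type u} [Field K] (W : WeierstrassCurve K) (p M : ℕ) [hp : Fact p.Prime]

/-- `E[p^∞]` is `p^M`-divisible (granted the divisibility of `E(K̄)`). [cite: Greenberg1999, §2 (p. 62)] -/
theorem exists_pow_nsmul_eq_geomPrimaryTorsion (hdiv : W.zsmul_geomPoints_surjective) [W.IsElliptic]
    (a : geomPrimaryTorsion W p) : ∃ b : geomPrimaryTorsion W p, (p ^ M) • b = a := by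
  obtain ⟨j, hj⟩ := a.2
  obtain ⟨B, hB⟩ := exists_nsmul_eq_geomPoints W hdiv (pow_ne_zero M hp.out.ne_zero) (a : geomPoints W)
  refine ⟨⟨B, ⟨j + M, ?_⟩⟩, Subtype.ext (by rw [AddSubgroupClass.coe_nsmul]; exact hB)⟩
  rw [pow_add, mul_smul, hB]
  exact hj

/-- **`H¹(K, E[p^M]) ↠ H¹(K, E[p^∞])[p^M]`** for the named map `torsionPowToPrimaryH1`: every `p^M`-torsion class of
`H¹(K, E[p^∞])` comes from `H¹(K, E[p^M])` (if `p^M [φ] = 0` then `p^M φ = ∂a`, `a = p^M b`, and `φ − ∂b` takes values in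
`E[p^M]`). [cite: Greenberg1999, §5 (p. 114, proof of Prop. 5.8)] -/
theorem exists_torsionPowToPrimaryH1_eq (hdiv : W.zsmul_geomPoints_surjective) [W.IsElliptic]
    {x : galH1Primary W p} (hx : (p ^ M) • x = 0) :
    ∃ y : galH1Torsion W ((p ^ M : ℕ) : ℤ), torsionPowToPrimaryH1 W p M y = x := by
  obtain ⟨φ, rfl⟩ := oneCocycleClass_surjective _ x
  have h := oneCocycleClass_smul
    (discreteTopRep (Field.absoluteGaloisGroup K) (geomPrimaryTorsion W p)) ((p ^ M : ℕ) : ℤ) φ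
  conv at h => rhs; rw [Nat.cast_smul_eq_nsmul, hx]
  obtain ⟨a, ha⟩ := (oneCocycleClass_eq_zero_iff _ _).mp h
  have ha' : ∀ σ : Field.absoluteGaloisGroup K, (p ^ M) • φ.1 σ = σ • a - a := fun σ => by
    rw [← natCast_zsmul]
    exact ha σ
  obtain ⟨b, rfl⟩ := exists_pow_nsmul_eq_geomPrimaryTorsion W p M hdiv a
  set φ' := φ - cobCocycle b (continuous_smul_geomPrimaryTorsion W p b) with hφ'
  have hval : ∀ σ : Field.absoluteGaloisGroup K, (p ^ M) • φ'.1 σ = 0 := fun σ => by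
    change (p ^ M) • (φ.1 σ - (σ • b - b)) = 0
    rw [smul_sub, ha', smul_sub, smul_comm, sub_self]
  have hmem : ∀ σ : Field.absoluteGaloisGroup K,
      ((φ'.1 σ : geomPrimaryTorsion W p) : geomPoints W) ∈ geomTorsion W ((p ^ M : ℕ) : ℤ) := fun σ =>
    AddSubgroup.torsionBy.nsmul_iff.mpr (by
      rw [← AddSubgroupClass.coe_nsmul, hval σ, ZeroMemClass.coe_zero])
  let χ : contOneCocycles (discreteTopRep (Field.absoluteGaloisGroup K) (geomTorsion W ((p ^ M : ℕ) : ℤ))) :=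
    contOneCocycles.lift (AddSubgroup.inclusion (geomTorsion_pow_le_geomPrimaryTorsion W p M))
      (fun _ _ => rfl) (AddSubgroup.inclusion_injective _) φ' (fun σ => ⟨_, hmem σ⟩)
      (fun _ => rfl)
  refine ⟨oneCocycleClass _ χ, ?_⟩
  rw [torsionPowToPrimaryH1_oneCocycleClass, contOneCocycles.push_lift, hφ', oneCocycleClass_sub,
    oneCocycleClass_cobCocycle, sub_zero]

section NumberField

variable [NumberField K]

omit hp in
/-- **`Sel^(p^M)(E/K)` is exactly the preimage of `Sel_{p^∞}(E/K)`** under `torsionPowToPrimaryH1` (both Selmer groups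
are the preimages of `Ш(E/K)` under maps that agree). [cite: Greenberg1999, §2 (p. 63)] [cite: SilvermanAEC2009, X.§4] -/
theorem torsionPowToPrimaryH1_mem_selmerGroupPInfty_iff (y : galH1Torsion W ((p ^ M : ℕ) : ℤ)) :
    torsionPowToPrimaryH1 W p M y ∈ selmerGroupPInfty W p ↔ y ∈ selmerGroup W ((p ^ M : ℕ) : ℤ) := by
  rw [selmerGroup_eq_comap_sha, selmerGroupPInfty_eq_comap_sha, AddSubgroup.mem_comap, AddSubgroup.mem_comap,
    primaryH1ToH1_torsionPowToPrimaryH1]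

/-- **`Sel^(p^M)(E/K) ↠ Sel_{p^∞}(E/K)[p^M]`.** [cite: Greenberg1999, §2 (p. 63), §5 (p. 114)] -/
theorem exists_mem_selmerGroup_torsionPowToPrimaryH1_eq (hdiv : W.zsmul_geomPoints_surjective) [W.IsElliptic]
    {x : galH1Primary W p} (hx : x ∈ selmerGroupPInfty W p) (hpx : (p ^ M) • x = 0) :
    ∃ y ∈ selmerGroup W ((p ^ M : ℕ) : ℤ), torsionPowToPrimaryH1 W p M y = x := by
  obtain ⟨y, rfl⟩ := exists_torsionPowToPrimaryH1_eq W p M hdiv hpx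
  exact ⟨y, (torsionPowToPrimaryH1_mem_selmerGroupPInfty_iff W p M y).mp hx, rfl⟩

end NumberField

section Conj

variable {L : Type u} [Field L] [CharZero L] (V : WeierstrassCurve ℚ) (q N : ℕ)
  {σ : L ≃ₐ[ℚ] L} {τ : AlgebraicClosure L ≃+* AlgebraicClosure L}

/-- **`H¹(K, E[p^M]) → H¹(K, E[p^∞])` is `Aut(K/ℚ)`-equivariant**: for a lift `τ` of `σ`,
`σ_* ∘ ι_M = ι_M ∘ σ_*` (`conjH1Primary` on `H¹(K, E[p^∞])`, `conjH1` on `H¹(K, E[p^M])`) — both composites are the map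
of the compatible pair `(conjGalCMH, E[p^M] → E[p^∞], P ↦ τP)`. With `IsLiftOfAut.conjH1_eq_conjAct` this is the
`τ`-equivariance of the dictionary needed to transport the `τ`-eigen-decomposition of the divisible part of
`Sel_{p^∞}(E/K)` to every level. [cite: GrossLMS1991, §5 (5.1)] [cite: Greenberg1999, §2 (p. 63)] -/
theorem conjH1Primary_torsionPowToPrimaryH1 (hτ : IsLiftOfAut σ τ) (y : galH1Torsion (V.baseChange L) ((q ^ N : ℕ) : ℤ)) :
    hτ.conjH1Primary V q (torsionPowToPrimaryH1 (V.baseChange L) q N y) =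
      torsionPowToPrimaryH1 (V.baseChange L) q N (hτ.conjH1 V ((q ^ N : ℕ) : ℤ) y) := by
  have hconj : hτ.conjH1 V ((q ^ N : ℕ) : ℤ) =
      resH1Hom hτ.conjGalCMH (hτ.torsionMap V ((q ^ N : ℕ) : ℤ)) (hτ.torsionMap_smul V ((q ^ N : ℕ) : ℤ)) := rfl
  rw [IsLiftOfAut.conjH1Primary, torsionPowToPrimaryH1, hconj, resH1Hom_resH1Hom, resH1Hom_resH1Hom]
  exact congrFun (congrArg DFunLike.coe (resH1Hom_congr (by ext; rfl)
    (AddMonoidHom.ext fun P ↦ Subtype.ext rfl) _ _)) y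

/-- The same for the canonical action `conjAct` (any lift computes it). [cite: GrossLMS1991, §5 (5.1)] -/
theorem conjH1Primary_torsionPowToPrimaryH1_conjAct (y : galH1Torsion (V.baseChange L) ((q ^ N : ℕ) : ℤ)) :
    (isLiftOfAut_liftAut σ).conjH1Primary V q (torsionPowToPrimaryH1 (V.baseChange L) q N y) =
      torsionPowToPrimaryH1 (V.baseChange L) q N (conjAct V σ ((q ^ N : ℕ) : ℤ) y) := by
  rw [← (isLiftOfAut_liftAut σ).conjH1_eq_conjAct V]
  exact conjH1Primary_torsionPowToPrimaryH1 V q N (isLiftOfAut_liftAut σ) y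

end Conj

end Summit.BirchSwinnertonDyer.BirchSwinnertonDyer.Theorems.KolyvaginAtTwo.RegularWalk

end
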